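import Summits.AtomisticToContinuum.HydrodynamicLimit.Theorems.ImplosionDichotomyDenseExcursionConeLocalityMain
import Summits.AtomisticToContinuum.HydrodynamicLimit.Theorems.ImplosionDichotomyDenseExcursionConeDefs

/-!
# Cone locality for the hard-sphere / athermal `5 × 5` Euler system (line `kidder-knob-melnikov`, stub
# `stub_coneLocality`)

Crux `Summit.AtomisticToContinuum.HydrodynamicLimit.Theses.ImplosionDichotomy.DenseExcursion`
(stmt-AtomisticToContinuum-12586), skeleton `Cruxes/DenseExcursion/Lines/kidder_knob_melnikov.lean`, registered stub
`stub_coneLocality : HsEulerConeLocality` (`…ConeDefs.lean`): domain of dependence in acoustic cones for two `C¹`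
solutions of the primitive full Euler system of a monatomic fluid with ONE smooth athermal pressure law
`p = PΘζ(P)` (Dafermos, Hyperbolic Conservation Laws in Continuum Physics, 2nd ed. 2005, Thm 5.2.1, classical case;
the `5 × 5` analogue of `Literature.Analysis.FluidPDE.IsentropicEuler.eqOn_cone_of_eqOn_ball`).

The energy method proper is `ConeLocality.eqOn_cone5` (previous file), stated for pressure coefficients
`ζ, γ ∈ C¹(ℝ)`. Here `ζ` is only smooth on an open `J ⊇ [a, b]`; since the equations, the speed bound and the
hyperbolicity hypothesis only evaluate `ζ` and `ζ'` at densities lying in `[a, b]`, we may replace `ζ` by a globally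
smooth function agreeing with it near `[a, b]` (`ConeLocality.exists_contDiff_extension`) and take
`γ = ζ + id·ζ'`; `stub_coneLocality` is this bookkeeping.
-/

noncomputable section

open Set Filter MeasureTheory Metric
open scoped Topology ContDiff RealInnerProductSpace

namespace Summit.AtomisticToContinuum.HydrodynamicLimit.Theorems.KidderKnobMelnikov

open Literature.MathematicalPhysics.KineticTheory (V3)

/-- **Cone locality for the athermal `5 × 5` Euler system** (registered stub `stub_coneLocality` of line
`kidder-knob-melnikov`): `HsEulerConeLocality` holds — two `C¹` triples on the slab `[0, t₁) × ℝ³` solving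
`AthermalEulerAt ζ` on the open cone `‖x − x₀‖ + ct < R` with densities in `[a, b] ⊆ J` (`J` open, `ζ ∈ C^∞(J)`,
`a > 0`, `ζ + rζ' > 0` on `[a, b]`), positive temperatures there, `c ≥ ‖U₁‖ + c_s` on the cone and equal data on
the ball agree on the cone. Reduction to `ConeLocality.eqOn_cone5` with a globally smooth replacement of `ζ`.
[cite: Dafermos2005, §5.2, Thm 5.2.1] -/
theorem stub_coneLocality : HsEulerConeLocality := by
  intro ζ J a b hJ hζ hab ha hγ P₁ Θ₁ P₂ Θ₂ U₁ U₂ x₀ R c t₁ hP₁ hΘ₁ hU₁ hP₂ hΘ₂ hU₂ hrange hE hc hspeed h0 t ht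
    x hx
  -- `a ≤ b`, or the hypotheses are vacuous at `(t, x)`
  rcases le_or_gt a b with hle | hlt
  swap
  · exact absurd (hrange t ht x hx).1 fun h => (not_le.2 hlt) (h.1.trans h.2)
  -- a globally smooth replacement of `ζ`
  obtain ⟨ζ', hζ', O, hO, habO, hEq⟩ := ConeLocality.exists_contDiff_extension hJ hζ hab hle
  have hD : ∀ r ∈ O, deriv ζ' r = deriv ζ r := fun r hr =>
    Filter.EventuallyEq.deriv_eq (Filter.eventuallyEq_of_mem (hO.mem_nhds hr) hEq)
  have hζ'1 : ContDiff ℝ 1 ζ' := hζ'.of_le (by simp)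
  have hdζ' : ContDiff ℝ 1 (deriv ζ') := (contDiff_infty_iff_deriv.1 hζ').2.of_le (by simp)
  have hγ'1 : ContDiff ℝ 1 fun r => ζ' r + r * deriv ζ' r := hζ'1.add (contDiff_id.mul hdζ')
  have hγ'pos : ∀ r ∈ Icc a b, 0 < ζ' r + r * deriv ζ' r := fun r hr => by
    rw [hEq (habO hr), hD r (habO hr)]; exact hγ r hr
  -- rewrite the equations and the speed bound with `ζ'`
  refine ConeLocality.eqOn_cone5 (γ := fun r => ζ' r + r * deriv ζ' r) hζ'1 hγ'1 ha hγ'pos hP₁ hΘ₁ hU₁ hP₂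
    hΘ₂ hU₂ (fun s hs y hy => ⟨(hrange s hs y hy).1, (hrange s hs y hy).2.1, (hrange s hs y hy).2.2.1⟩)
    (fun s hs y hy => ?_) hc (fun s hs y hy => ?_) h0 t ht x hx
  · obtain ⟨h1, h2⟩ := hE s hs y hy
    obtain ⟨hr1, hr2, -, -⟩ := hrange s (Ioo_subset_Ico_self hs) y hy
    unfold AthermalEulerAt at h1 h2
    rw [← hEq (habO hr1), ← hD _ (habO hr1)] at h1
    rw [← hEq (habO hr2), ← hD _ (habO hr2)] at h2
    exact ⟨h1, h2⟩
  · obtain ⟨hr1, -, -, -⟩ := hrange s (Ioo_subset_Ico_self hs) y hy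
    have h := hspeed s hs y hy
    rw [← hEq (habO hr1), ← hD _ (habO hr1)] at h
    exact h

end Summit.AtomisticToContinuum.HydrodynamicLimit.Theorems.KidderKnobMelnikov

end
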